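import Literature.AlgebraicGeometry.Resolution.LocalRegLeificationOfSandwiched
import Literature.AlgebraicGeometry.Morphisms.OpenGluingProofs
import Summits.ResolutionOfSingularities.ResolutionOfSingularities.Theorems.PAlterationPialtAtomsOpenRange
import Mathlib.Topology.KrullDimension
import HarnessLib

/-!
# ResolutionOfSingularities / UniversalCells — crux `LocalToGlobal`, line `birth` (v3.2):
# local RegLe-ification of a morphism of proper models of transcendence degree `≤ n` from
# strong resolution of sandwiched `k`-schemes over regular bases of dimension `≤ n`

Crux `stmt-ResolutionOfSingularities-15232`, decl `UniversalCells.LocalToGlobal`, stub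
`stub_localRegLeificationAt_of_sandwichedStrong_dimLe` of the dimension-split line `birth` v3.2
(cycle 2).

Let `k` be a field and `n : ℕ`. Assume SAND⁺ below dimension `n` over `k`: every integral `V`
proper and birational over a REGULAR integral separated finite-type `k`-scheme `U` of (topological
Krull) dimension `≤ n` has a resolution `π : Y → V` which is an isomorphism over an open `W ⊆ V`
whose points are exactly `Reg V`. Then for every field extension `K/k` essentially of finite type
with `trdeg_k K ≤ n` and every morphism `φ : M → Y` of proper models of `K/k` there are an open
`O ⊆ M` containing `Reg M` and `φ⁻¹(Reg Y)`, an integral scheme `N` and a proper birational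
`ρ : N → O` whose points over `Reg M` and over `φ⁻¹(Reg Y)` are regular — the body of
`ProperModel.LocalRegLeification` for this one `(k, K, φ)`.

Proof: the per-`(k, K, φ)` body of the landed
`Literature.AlgebraicGeometry.Resolution.ProperModel.localRegLeification_of_sandwiched`
(Zariski 1944; Piltant 2013, proof of Prop. 5.1, Steps 4–5) with the dimension threaded through.
Put `U := Reg Y` (open, `isOpen_regularLocus_of_locallyOfFiniteType_field`; it contains the generic
point) and `V := φ⁻¹(U)`; `V → U` is proper and birational (`ProperModel.Hom.isBirational`
restricted to `U`) over the regular integral separated finite-type `k`-scheme `U`, and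
`dim U ≤ dim Y = trdeg_k K ≤ n` (`Topology.IsInducing.topologicalKrullDim_le` along the open
immersion `U ↪ Y`, `Pialt.OpenRange.properModel_topologicalKrullDim_le_of_trdeg_le`). So the
hypothesis resolves `V` by a `π : Yv → V` which is an isomorphism over `Reg V`, and
`exists_localRegLeification_data OpenGluing_holds` glues `Yv` to `M ∖ closure (Sing V)`.

## References

* O. Zariski, *Reduction of the singularities of algebraic three dimensional varieties*,
  Ann. of Math. 45 (1944), Fundamental Theorem p. 539 (via Piltant).
* O. Piltant, *An axiomatic version of Zariski's patching theorem*, RACSAM 107 (2013) 91–121,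
  proof of Prop. 5.1, Steps 4–5. [Piltant2013]
-/

-- `Summit.<Summit>.<Sub>.Theorems` with `Sub = Summit` (single-conjunct summit, D-0017)
set_option linter.dupNamespace false

noncomputable section

open CategoryTheory AlgebraicGeometry TopologicalSpace
open Literature.AlgebraicGeometry.Resolution Literature.AlgebraicGeometry.Morphisms

namespace Summit.ResolutionOfSingularities.ResolutionOfSingularities.Theorems

/-- **SAND⁺ over `k` below dimension `n` ⇒ local RegLe-ification of morphisms of proper models of
transcendence degree `≤ n`** (Zariski 1944; Piltant 2013, proof of Prop. 5.1, Steps 4–5,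
one-morphism form, dimension threaded through): for a morphism `φ : M → Y` of proper models of
`K/k`, `trdeg_k K ≤ n`, let `U := Reg Y` (open, containing the generic point) and `V := φ⁻¹(U)`.
Then `V → U` is proper and birational over the regular integral separated finite-type `k`-scheme
`U` of dimension `≤ dim Y = trdeg_k K ≤ n`, so the dimension-bounded strong sandwiched
resolution `hS` gives `π : Yv → V`, an isomorphism over `Reg V`; `exists_localRegLeification_data`
(with `OpenGluing_holds`) glues it to `M ∖ closure (Sing V)`, producing the open
`O ⊇ Reg M ∪ φ⁻¹(Reg Y)` and the proper birational integral `N → O` regular over both loci.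
[cite: Piltant2013, proof of Prop. 5.1, Steps 4-5] -/
theorem stub_localRegLeificationAt_of_sandwichedStrong_dimLe (k : Type) [Field k] (n : ℕ)
    (hS : ∀ (U V : Scheme.{0}) (f : U ⟶ Spec (.of k)) (η : V ⟶ U), IsSeparated f →
      LocallyOfFiniteType f → QuasiCompact f → IsIntegral U → Scheme.IsRegular U → IsIntegral V →
      IsProper η → IsBirational η → topologicalKrullDim U ≤ n →
        ∃ (Y : Scheme.{0}) (π : Y ⟶ V), IsResolution π ∧
          ∃ W : V.Opens, (W : Set V) = Scheme.regularLocus V ∧ IsIso (π ∣_ W))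
    (K : Type) [Field K] [Algebra k K] [Algebra.EssFiniteType k K] (hK : Algebra.trdeg k K ≤ n)
    (M Y : ProperModel k K) (φ : M.Hom Y) :
    ∃ (O : M.X.Opens) (N : Scheme.{0}) (ρ : N ⟶ (O : Scheme.{0})),
      IsIntegral N ∧ IsProper ρ ∧ IsBirational ρ ∧
      (∀ m : M.X, IsRegularLocalRing (M.X.presheaf.stalk m) → m ∈ O) ∧
      (∀ m : M.X, IsRegularLocalRing (Y.X.presheaf.stalk (φ.f m)) → m ∈ O) ∧
      (∀ n : N, IsRegularLocalRing (M.X.presheaf.stalk (ρ n).1) →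
        IsRegularLocalRing (N.presheaf.stalk n)) ∧
      (∀ n : N, IsRegularLocalRing (Y.X.presheaf.stalk (φ.f (ρ n).1)) →
        IsRegularLocalRing (N.presheaf.stalk n)) := by
  -- the open `U = Reg Y` and the generic points
  let U : Y.X.Opens :=
    ⟨Scheme.regularLocus Y.X, isOpen_regularLocus_of_locallyOfFiniteType_field Y.π⟩
  have hgenY : genericPoint Y.X ∈ U := by
    show genericPoint Y.X ∈ Scheme.regularLocus Y.X
    apply Scheme.genericPoints_subset_regularLocus
    rw [genericPoints_eq_singleton]
    rfl
  have hφgen : φ.f (genericPoint M.X) = genericPoint Y.X := by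
    rw [← M.genericPt_eq, ← Scheme.Hom.comp_apply, φ.gen_f]
    exact Y.genericPt_eq
  have hgenM : genericPoint M.X ∈ φ.f ⁻¹ᵁ U := by
    show φ.f (genericPoint M.X) ∈ U
    rw [hφgen]
    exact hgenY
  haveI : Nonempty (U : Scheme.{0}) := ⟨⟨_, hgenY⟩⟩
  haveI : Nonempty (↑(φ.f ⁻¹ᵁ U) : Scheme.{0}) := ⟨⟨_, hgenM⟩⟩
  haveI : IsIntegral (U : Scheme.{0}) := isIntegral_of_isOpenImmersion U.ι
  haveI : IsIntegral (↑(φ.f ⁻¹ᵁ U) : Scheme.{0}) :=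
    isIntegral_of_isOpenImmersion (φ.f ⁻¹ᵁ U).ι
  have hUreg : Scheme.IsRegular (U : Scheme.{0}) := fun u =>
    (isRegularLocalRing_stalk_iff_of_isOpenImmersion U.ι u).mp u.2
  -- the dimension bound: `dim U ≤ dim Y = trdeg_k K ≤ n`
  have hdimU : topologicalKrullDim (U : Scheme.{0}) ≤ n :=
    (U.ι.isOpenEmbedding.isInducing.topologicalKrullDim_le).trans
      (Pialt.OpenRange.properModel_topologicalKrullDim_le_of_trdeg_le Y (d := n)
        (by exact_mod_cast hK))
  -- SAND⁺ (dimension `≤ n`) for the sandwiched piece `φ⁻¹(U) → U` over `U → Spec k`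
  obtain ⟨Yv, π, hres, W, hW, hπW⟩ := hS (U : Scheme.{0}) (↑(φ.f ⁻¹ᵁ U)) (U.ι ≫ Y.π)
    (φ.f ∣_ U) inferInstance inferInstance inferInstance inferInstance hUreg inferInstance
    inferInstance (φ.isBirational.morphismRestrict U) hdimU
  haveI := hres.isProper
  haveI := hπW
  haveI : IsIntegral Yv := by
    haveI := hres.isRegular.isReduced
    exact hres.isBirational.isIntegral
  -- glue
  obtain ⟨O, N, ρ, hN, hρ, hbir, hRegO, hVO, h6, h7⟩ :=
    exists_localRegLeification_data OpenGluing_holds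
      (isOpen_regularLocus_of_locallyOfFiniteType_field M.π) (φ.f ⁻¹ᵁ U) π hres.isRegular W hW
  refine ⟨O, N, ρ, hN, hρ, hbir, fun m hm => hRegO hm, fun m hm => hVO ?_, h6,
    fun n hn => h7 n hn⟩
  exact hm

end Summit.ResolutionOfSingularities.ResolutionOfSingularities.Theorems

end
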